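import Summits.Ventures.AbcSig.Sieve.CharpolySieve

/-!
# Venture AbcSig — ALL-exponent norm-form certificates (characteristic polynomials, [BS04, Prop. 4.3] as printed)

HONEST FRAMING. Certificate checker of a COMPUTATION cell (`pub-abcsig`); no Diophantine statement, no claim on ABC or
any summit. `Sieve/CharpolySieve.lean` proves, for ONE exponent `n`, that the Boolean `cpKills cp A n N` ("some listed odd
prime `ℓ ≠ n`, `ℓ ∤ N`, has `n ∤ P_ℓ(t)` for every allowed trace `t`") together with the CITED `BS04Package` and the COMPUTED
`RefinesCP N o cp` (the listed `P_ℓ` annihilate `c_ℓ` on the newforms matching `o`) excludes the orbit at `n`. THIS FILE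
certifies `cpKills` for ALL primes `n` outside an explicit finite list at once: with the modulus
`m_ℓ = ℓ · ∏_{t ∈ A ℓ} |P_ℓ(t)|` of an entry, if the prime `n` is not among the prime bases of `∏ p^e = gcd_ℓ m_ℓ` then
`n ∤ m_ℓ` for some listed `ℓ`, whence `ℓ ≠ n` and `n ∤ P_ℓ(t)` for every allowed `t`. The check `cpCheck cp A N fac`
(entries at odd primes not dividing `N`; `gcd` of the moduli `= ∏ p^e`) is evaluated by the kernel (`decide`; `Nat.gcd` on
large literals is cheap there), the primality of the (small) bases separately (`norm_num`), and THEOREM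
`cpKills_of_cpCheck` / `NewformModel.excludesStd_of_cpCheck` turn it into `M.ExcludesStd N o n` for every prime `n` off the
base list. This is the printed norm method of [BS04, Prop. 4.3, p. 42]; it is basis independent (no `ℤ[θ]` index
artefacts) but, for a prime `n` that splits in the Hecke field, it can be weaker than the prime-ideal sieve of
`Sieve/Certificate.lean` (it cannot see that different primes above `n` fail at different `ℓ`); level files built on it say
so per orbit and fall back to `Sieve/Certificate.lean` trees where the difference matters.
Also: `NewformModel.RefinesCPAll` (the per-level list form of the `RefinesCP` hypotheses such a level file takes, with its
`append` bookkeeping for part files).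

Reference: [BS04] Bennett–Skinner, Canad. J. Math. 56 (2004), Prop. 4.3 and p. 42.
-/

namespace Summit.Ventures.AbcSig

/-! ## The modulus of an entry and the certificate check -/

/-- The modulus of a characteristic-polynomial entry for the allowed-trace function `A`:
`m = ℓ · ∏_{t ∈ A ℓ} |P_ℓ(t)|` (the factor `ℓ` records that the entry says nothing about the exponent `n = ℓ`). -/
def CPEntry.modulus (e : CPEntry) (A : ℕ → List ℤ) : ℕ :=
  e.ell * ((A e.ell).map fun t => (hornerZ e.P t).natAbs).prod

/-- `gcd` of a list of natural numbers (`0` for the empty list). -/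
def gcdList : List ℕ → ℕ
  | [] => 0
  | m :: l => Nat.gcd m (gcdList l)

/-- A number dividing every member of a list divides its `gcdList`. -/
lemma dvd_gcdList (n : ℕ) : ∀ l : List ℕ, (∀ m ∈ l, n ∣ m) → n ∣ gcdList l
  | [], _ => by simp [gcdList]
  | m :: l, h => by
      simp only [gcdList]
      exact Nat.dvd_gcd (h m (by simp)) (dvd_gcdList n l fun m' hm' => h m' (by simp [hm']))

/-- Well-formedness of the entries (Boolean): every listed `ℓ` is an odd prime not dividing the level `N`. -/
def cpWellformed (cp : List CPEntry) (N : ℕ) : Bool :=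
  cp.all fun e => decide e.ell.Prime && decide (e.ell ≠ 2) && decide (¬ e.ell ∣ N)

/-- **The all-exponent norm-form check** (computable, evaluated by `decide`): the entries are well formed and the `gcd`
of their moduli equals `∏ p^e` over the listed `(p, e)`. (Primality of the bases `p` is NOT part of this Boolean — it is
supplied separately, by `norm_num`, to keep the kernel away from trial division of large literals.) -/
def cpCheck (cp : List CPEntry) (A : ℕ → List ℤ) (N : ℕ) (fac : List (ℕ × ℕ)) : Bool :=
  cpWellformed cp N && (gcdList (cp.map fun e => e.modulus A) == facProd fac)

/-- **Soundness.** If `cpCheck cp A N fac` holds and every base of `fac` is prime, then for every prime `n` that is not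
a base, `cpKills cp A n N`: otherwise `n` would divide every modulus (it divides `m_ℓ` through the factor `ℓ` when
`ℓ = n`, and through `|P_ℓ(t)|` for an allowed `t` with `n ∣ P_ℓ(t)` otherwise), hence their `gcd = ∏ p^e`, hence it
would be a base. -/
theorem cpKills_of_cpCheck (cp : List CPEntry) (A : ℕ → List ℤ) (N : ℕ) (fac : List (ℕ × ℕ))
    (h : cpCheck cp A N fac = true) (hprimes : ∀ pe ∈ fac, pe.1.Prime) (n : ℕ) (hn : n.Prime)
    (hmem : n ∉ fac.map Prod.fst) : cpKills cp A n N = true := by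
  unfold cpCheck at h
  simp only [Bool.and_eq_true, beq_iff_eq] at h
  obtain ⟨hwf, hg⟩ := h
  have hex : ∃ e ∈ cp, ¬ n ∣ e.modulus A := by
    by_contra hall
    push Not at hall
    apply hmem
    apply mem_bases_of_prime_dvd_facProd hn fac hprimes
    rw [← hg]
    refine dvd_gcdList n _ fun m hm => ?_
    obtain ⟨e, he, rfl⟩ := List.mem_map.mp hm
    exact hall e he
  obtain ⟨e, he, hnd⟩ := hex
  simp only [cpWellformed, List.all_eq_true, Bool.and_eq_true, decide_eq_true_eq] at hwf
  obtain ⟨⟨hp, h2⟩, hN⟩ := hwf e he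
  simp only [cpKills, List.any_eq_true, Bool.and_eq_true, decide_eq_true_eq, List.all_eq_true]
  refine ⟨e, he, ⟨⟨⟨⟨hp, h2⟩, ?_⟩, hN⟩, ?_⟩⟩
  · rintro rfl
    exact hnd (Dvd.intro _ rfl)
  · intro t ht
    simp only [bne_iff_ne, ne_eq]
    intro h0
    apply hnd
    have hdvd : (n : ℤ) ∣ hornerZ e.P t := Int.dvd_of_emod_eq_zero h0
    have habs : n ∣ (hornerZ e.P t).natAbs := Int.natCast_dvd.mp hdvd
    exact dvd_mul_of_dvd_right (habs.trans (List.dvd_prod (List.mem_map.mpr ⟨t, ht, rfl⟩))) e.ell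

/-- **[BS04, Prop. 4.3], norm form, all exponents at once.** A checked norm-form certificate with prime bases excludes
the orbit `o` at every prime exponent `n` off the base list, modulo the CITED `BS04Package` and the COMPUTED
`RefinesCP N o cp`. -/
theorem NewformModel.excludesStd_of_cpCheck (M : NewformModel) (hP : M.BS04Package) {N : ℕ} (o : OrbitData)
    (cp : List CPEntry) (fac : List (ℕ × ℕ)) (h : cpCheck cp bs04Allowed N fac = true)
    (hprimes : ∀ pe ∈ fac, pe.1.Prime) (hRef : M.RefinesCP N o cp) (n : ℕ) (hn : n.Prime)
    (hmem : n ∉ fac.map Prod.fst) : M.ExcludesStd N o n :=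
  M.excludesStd_of_cpKills hP o cp hRef n (cpKills_of_cpCheck cp bs04Allowed N fac h hprimes n hn hmem)

/-! ## Per-level bookkeeping of the computed `RefinesCP` hypotheses -/

/-- **COMPUTED HYPOTHESIS, per level**: every listed pair `(o, cp)` satisfies `M.RefinesCP N o cp` (the characteristic
polynomials belong to the orbit; same engine level file as `DataComplete`). -/
def NewformModel.RefinesCPAll (M : NewformModel) (N : ℕ) (L : List (OrbitData × List CPEntry)) : Prop :=
  ∀ oc ∈ L, M.RefinesCP N oc.1 oc.2

/-- `RefinesCPAll` of a concatenation is the conjunction. -/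
theorem NewformModel.refinesCPAll_append (M : NewformModel) (N : ℕ) (L₁ L₂ : List (OrbitData × List CPEntry)) :
    M.RefinesCPAll N (L₁ ++ L₂) ↔ M.RefinesCPAll N L₁ ∧ M.RefinesCPAll N L₂ := by
  unfold NewformModel.RefinesCPAll
  exact List.forall_mem_append

/-- Extracting one member of a `RefinesCPAll` hypothesis. -/
theorem NewformModel.RefinesCPAll.of_mem {M : NewformModel} {N : ℕ} {L : List (OrbitData × List CPEntry)}
    (h : M.RefinesCPAll N L) {o : OrbitData} {cp : List CPEntry} (hmem : (o, cp) ∈ L) : M.RefinesCP N o cp :=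
  h (o, cp) hmem

/-! ## Toy certificate (kernel-evaluated): one entry `ℓ = 3`, `P = x² − 2`, allowed traces
`bs04Allowed 3 = [-4, -2, 0, 2, 4]`: `|P(t)| = 14, 2, 2, 2, 14`, modulus `3 · 14 · 2 · 2 · 2 · 14 = 4704 = 2⁵ · 3 · 7²`;
so every prime `n ∉ {2, 3, 7}` kills. -/

/-- Toy entry list. -/
def toyCP : List CPEntry := [⟨3, [-2, 0, 1]⟩]

/-- The toy certificate passes the check at a level prime to `3`. -/
example : cpCheck toyCP bs04Allowed 50 [(2, 5), (3, 1), (7, 2)] = true := by decide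

/-- Hence the toy entry list kills, e.g., the exponent `11`. -/
example : cpKills toyCP bs04Allowed 11 50 = true :=
  cpKills_of_cpCheck toyCP bs04Allowed 50 [(2, 5), (3, 1), (7, 2)] (by decide) (by decide) 11 (by norm_num) (by decide)

end Summit.Ventures.AbcSig
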